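import Literature.AnabelianGeometry.SemiGraphs.TemperedCoverings

/-!
# Locally trivial coverings are tempered ([SemiAnbd] §3 p. 38) — proofs

Proof-only file over `TemperedCoverings.lean` (frozen v2).  [SemiAnbd] §3 p. 38: "Thus, the
`𝒢_{∞,i} → 𝒢` are tempered coverings of `𝒢`" — the coverings determined by graph-coverings of
the underlying semi-graph (locally trivial coverings, Remark 3.5.1 p. 37: all constituent actions
trivial) are tempered in the sense of Definition 3.5 (ii): the one-point finite étale covering
(the terminal object of `B(𝒢)`) splits them at every point, since there is nothing to split.

Main result: `CovObj.isTempered_of_trivial` — an object of `B^cov(𝒢)` all of whose constituent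
actions are trivial is tempered.  (Applied in `UniversalCoveringObj.lean`'s sequel to
`𝒢_∞ = univCoverObj`.)
-/

namespace Literature.AnabelianGeometry.SemiGraphs

namespace ProfiniteSemiGraph

open CategoryTheory

universe u

variable {𝒢 : ProfiniteSemiGraph.{u}}

/-- **A locally trivial covering is tempered** ([SemiAnbd] p. 38 "the `𝒢_{∞,i} → 𝒢` are tempered
coverings"; Rmk. 3.5.1): if every `Π_v` and every `Π_e` acts trivially on the fibres of `S`, then
`S` is tempered — the one-point finite covering splits it everywhere.
[cite: MochizukiSemiAnbd2006, Prop 3.6 p.38] -/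
theorem CovObj.isTempered_of_trivial (S : CovObj 𝒢)
    (hV : ∀ (v : 𝒢.graph.Vertex) (g : 𝒢.Gv v) (x : (S.SV v).obj.V), (S.SV v).obj.ρ g x = x)
    (hE : ∀ (e : 𝒢.graph.Edge) (g : 𝒢.Ge e) (x : (S.SE e).obj.V), (S.SE e).obj.ρ g x = x) :
    S.IsTempered := by
  -- the one-point object of `B^temp(Π)` (trivial action)
  have unitMem : ∀ (G : Type u) [Group G] [TopologicalSpace G],
      temperedAction G ({ V := PUnit.{u + 1}, ρ := 1 } : Action (Type u) G) := by
    intro G _ _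
    refine ⟨inferInstanceAs (Countable PUnit.{u + 1}), fun x => ?_⟩
    have : {g : G | (1 : G →* End PUnit.{u + 1}) g x = x} = Set.univ :=
      Set.eq_univ_of_forall fun _ => rfl
    rw [this]
    exact isOpen_univ
  -- the one-point finite étale covering `𝟙` of `𝒢`
  let U : CovObj 𝒢 :=
    { SV := fun v => ⟨{ V := PUnit.{u + 1}, ρ := 1 }, unitMem (𝒢.Gv v)⟩
      SE := fun e => ⟨{ V := PUnit.{u + 1}, ρ := 1 }, unitMem (𝒢.Ge e)⟩
      glue := fun b v h => (temperedAction (𝒢.Ge (𝒢.graph.edgeOf b))).isoMk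
        (Action.mkIso (Iso.refl _) fun g => by
          apply ConcreteCategory.hom_ext
          intro x
          rfl) }
  intro p
  refine ⟨U, ⟨fun _ => inferInstanceAs (Finite PUnit.{u + 1}),
    fun _ => inferInstanceAs (Finite PUnit.{u + 1})⟩,
    ⟨fun _ => inferInstanceAs (Nonempty PUnit.{u + 1}), fun _ => inferInstanceAs (Nonempty PUnit.{u + 1})⟩,
    fun q _ => ?_⟩
  rcases q with ⟨v, s⟩ | ⟨e, s⟩
  · intro _ g _
    exact hV v g s
  · intro _ g _
    exact hE e g s

end ProfiniteSemiGraph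

end Literature.AnabelianGeometry.SemiGraphs
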